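/-
Copyright (c) 2026. All rights reserved.
Released under Apache 2.0 license as described in the file LICENSE.
Authors: abc-iut cell, wave-2 seat abc-iut-L3-t11 (gen 2; row (β)-3: the branch dictionary of a Galois tower —
the stabiliser of a compatible branch-pair system lies in two branch-conjugates, inside the level completion).
-/
import Literature.AnabelianGeometry.SemiGraphs.GaloisTowerBranchSystems
import Literature.AnabelianGeometry.SemiGraphs.TemperedPiDeckCompact
import HarnessLib

/-!
# [SemiAnbd] Thm 3.7 (iii), Comments (6)(b): stabilisers of compatible branch-pair systems along a Galois tower

Mochizuki, *Semi-graphs of anabelioids*, Publ. RIMS **42** (2006) [MochizukiSemiAnbd2006], proof of Thm. 3.7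
(iii) p. 41 with the author's *Comments* (2020), (6)(b): "the subjoints `(f_i, f'_i)` [pairs of distinct branches
at a common vertex of the finite level graphs `𝔾_i`, fixed by `H`] … converge, in the profinite topology, to some
profinite subjoint … [cf. Remark 2.2.1]", i.e. (Remark 2.2.1 p. 24, Definition 2.2 (i) p. 24 with the discussion on p. 23) an element fixing a
compatible system `(w_i; β_i ≠ β'_i)` lies, in the completion along the finite Galois levels, in
`ψ(x Π_b x⁻¹) ∩ ψ(x' Π_{b'} x'⁻¹)` for an embedding `ψ` of `Π_v` and two DISTINCT branch-cosets at `v` — which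
total estrangement then kills (abc-iut-L3-t11's `noFixedBranchPairSystem_of_isTotallyEstranged'`).

For Galois level data `D` (abc-iut-L3-t9, `TemperedPiSystem.lean`) with connected levels, a chart `c` mapped to
`D.temperedPi` by `ρ` (abc-iut-L3-t6's setting, `TemperedPiLevelDataOfTower.lean`):
* (from `GaloisLevelDescent.lean`) `D.levelGal = ∏ₙ Aut (D.S n)`, the completion of the tower along its FINITE
  GALOIS LEVELS as a bare group, and `D.toLevelGal : c.G →* D.levelGal`, `g ↦ (descendBaseAut_n (ρ_n g))_n`;
* **`GaloisLevelData.toLevelGal_mem_of_fixes_branchPairSystem`** — the CORE of the identification (I4′)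
  `FiniteLevelData.stabBranchPair'` for the tower: for every compatible system `(w_i; β_i ≠ β'_i)_{i ≥ j₀}` of a
  vertex with two distinct abutting branches of the level graphs `𝔾_{S i}`, there are `v`, distinct branch data
  `(b, x)`, `(b', x')` at `v` and an INJECTIVE `ψ : Π_v →* D.levelGal` (the limit of the base-point embeddings of
  `GaloisCoveringTorsor.lean` at compatible points `p_i ∈ w_i`; injective under the faithfulness (I0v) of `Π_v`
  on the tower's vertex fibres) with `toLevelGal g ∈ ψ(x Π_b x⁻¹) ⊓ ψ(x' Π_{b'} x'⁻¹)` for every `g` fixing the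
  system.  No injectivity of `toLevelGal` is claimed (that is Prop. 3.6 (iii) in tower form, true on compact
  subgroups / for cofinal towers — separate rows): the compact variant (I4′)_cpt is a 5-line corollary of the
  core under the injectivity-on-compacts input (`stabBranchPairCpt'_ofTower` = the v4 field
  `FiniteLevelDataCpt.stabBranchPairCpt'` of abc-iut-L3-t6's `TemperedLevelDataCpt.lean`, cell ruling α12-1,
  fed by abc-iut-L3-t6's (I0c)
  `injOn_pi_descendBaseAut_proj_of_isCompact` (`TemperedPiDeckCompact.lean`): `injOn_toLevelGal_of_isCompact`
  discharges the injectivity-on-compacts of `toLevelGal` for `ρ` continuous and injective, so that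
  `stabBranchPairCpt'_ofTower'` is (I4′)_cpt for the tower modulo (I0v) alone).
PROOF-ONLY. Nothing here takes a side on [IUTchIII] Cor. 3.12.
-/

namespace Literature.AnabelianGeometry.SemiGraphs

namespace ProfiniteSemiGraph

namespace GaloisLevelData

open CategoryTheory Topology
open scoped Pointwise
open Literature.AlgebraicGeometry.Frobenioids.QuasiTemperoid.BTempConnected (ρ_one_apply
  ρ_mul_apply ρ_inv_apply ρ_apply_inv)

universe u

variable {𝒢 : ProfiniteSemiGraph.{u}} (D : GaloisLevelData 𝒢) (h𝒢 : 𝒢.IsCountable)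
  (hconn : ∀ (n : ℕ) (p q : (D.S n).Point), (D.S n).SameComponent p q)

/-! ### Transition lemmas in pointwise form -/

/-- `levelTrans (n ≤ n+1) = 𝔾(g n)`. [cite: MochizukiSemiAnbd2006, Thm 3.7(iii) p.41] -/
theorem levelTrans_le_succ (n : ℕ) : D.levelTrans (Nat.le_succ n) = CovObj.orbitGraphMap (D.g n) := by
  rw [D.levelTrans_succ (le_refl n) (Nat.le_succ n), D.levelTrans_self, Category.comp_id]

/-- Transitions compose on vertices. [cite: MochizukiSemiAnbd2006, Thm 3.7(iii) p.41] -/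
theorem levelTrans_vertexMap_comp {i j k : ℕ} (hij : i ≤ j) (hjk : j ≤ k) (x : (D.S k).orbitGraph.Vertex) :
    (D.levelTrans hij).vertexMap ((D.levelTrans hjk).vertexMap x) = (D.levelTrans (hij.trans hjk)).vertexMap x := by
  rw [← D.levelTrans_comp hij hjk, SemiGraph.comp_vertexMap, Function.comp_apply]

/-- Transitions compose on branches. [cite: MochizukiSemiAnbd2006, Thm 3.7(iii) p.41] -/
theorem levelTrans_branchMap_comp {i j k : ℕ} (hij : i ≤ j) (hjk : j ≤ k) (x : (D.S k).orbitGraph.Branch) :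
    (D.levelTrans hij).branchMap ((D.levelTrans hjk).branchMap x) = (D.levelTrans (hij.trans hjk)).branchMap x := by
  rw [← D.levelTrans_comp hij hjk, SemiGraph.comp_branchMap, Function.comp_apply]

/-- Transitions preserve the base vertex of a vertex-orbit. [cite: MochizukiSemiAnbd2006, Thm 3.7(iii) p.41] -/
theorem base_levelTrans_vertexMap {i j : ℕ} (h : i ≤ j) (x : (D.S j).orbitGraph.Vertex) :
    CovObj.OVertex.base _ ((D.levelTrans h).vertexMap x) = CovObj.OVertex.base _ x := by
  have e := congrArg (fun φ => SemiGraph.Hom.vertexMap φ x) (D.levelTrans_proj h)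
  exact e

/-- Transitions preserve the base branch. [cite: MochizukiSemiAnbd2006, Thm 3.7(iii) p.41] -/
theorem proj_branchMap_levelTrans {i j : ℕ} (h : i ≤ j) (x : (D.S j).orbitGraph.Branch) :
    (D.S i).orbitGraphProj.branchMap ((D.levelTrans h).branchMap x) = (D.S j).orbitGraphProj.branchMap x := by
  have e := congrArg (fun φ => SemiGraph.Hom.branchMap φ x) (D.levelTrans_proj h)
  exact e

include hconn in
/-- Equivariance of the transitions on vertices, pointwise.
[cite: MochizukiSemiAnbd2006, Thm 3.7(iii) p.41] -/
theorem levelTrans_vertexMap_act (c : TemperedPiChart 𝒢) (ρ : c.G →* D.temperedPi h𝒢) (g : c.G) {i j : ℕ}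
    (h : i ≤ j) (x : (D.S j).orbitGraph.Vertex) :
    (D.levelTrans h).vertexMap ((D.levelAct h𝒢 hconn j (ρ g)).hom.vertexMap x) =
      (D.levelAct h𝒢 hconn i (ρ g)).hom.vertexMap ((D.levelTrans h).vertexMap x) := by
  have e := congrArg (fun φ => SemiGraph.Hom.vertexMap φ x) (D.levelTrans_act h𝒢 hconn h (ρ g))
  simpa only [SemiGraph.comp_vertexMap, Function.comp_apply] using e

include hconn in
/-- Equivariance of the transitions on branches, pointwise.
[cite: MochizukiSemiAnbd2006, Thm 3.7(iii) p.41] -/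
theorem levelTrans_branchMap_act (c : TemperedPiChart 𝒢) (ρ : c.G →* D.temperedPi h𝒢) (g : c.G) {i j : ℕ}
    (h : i ≤ j) (x : (D.S j).orbitGraph.Branch) :
    (D.levelTrans h).branchMap ((D.levelAct h𝒢 hconn j (ρ g)).hom.branchMap x) =
      (D.levelAct h𝒢 hconn i (ρ g)).hom.branchMap ((D.levelTrans h).branchMap x) := by
  have e := congrArg (fun φ => SemiGraph.Hom.branchMap φ x) (D.levelTrans_act h𝒢 hconn h (ρ g))
  simpa only [SemiGraph.comp_branchMap, Function.comp_apply] using e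

/-! ### The core of (I4′) for the tower -/

include hconn in
/-- **Stabilisers of compatible branch-pair systems lie in two distinct branch-conjugates** (the core of the
identification (I4′) `FiniteLevelData.stabBranchPair'` for a Galois tower; Comments (6)(b) with Remark 2.2.1 /
Definition 2.2 (i) at every finite level, and the passage to the limit by compactness of `Π_v`, `Π_e`): see the
module docstring.  Hypothesis (I0v) `hfaithV`: `Π_v` acts faithfully on the vertex fibres of the tower (used
only for the injectivity of `ψ`). [cite: MochizukiSemiAnbd2006, Thm 3.7(iii) p.41] -/
theorem toLevelGal_mem_of_fixes_branchPairSystem (c : TemperedPiChart 𝒢) (ρ : c.G →* D.temperedPi h𝒢)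
    (hfaithV : ∀ (v : 𝒢.graph.Vertex) (h : 𝒢.Gv v),
      (∀ (n : ℕ) (x : ((D.S n).SV v).obj.V), ((D.S n).SV v).obj.ρ h x = x) → h = 1)
    (j₀ : ℕ) (w : ∀ i : {i : ℕ // j₀ ≤ i}, (D.S i.1).orbitGraph.Vertex)
    (β β' : ∀ i : {i : ℕ // j₀ ≤ i}, (D.S i.1).orbitGraph.Branch)
    (hpair : ∀ i, β i ≠ β' i ∧ (D.S i.1).orbitGraph.abuts (β i) = some (w i) ∧
      (D.S i.1).orbitGraph.abuts (β' i) = some (w i))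
    (hcompat : ∀ ⦃i i' : {i : ℕ // j₀ ≤ i}⦄ (h : i.1 ≤ i'.1), (D.levelTrans h).vertexMap (w i') = w i ∧
      (D.levelTrans h).branchMap (β i') = β i ∧ (D.levelTrans h).branchMap (β' i') = β' i) :
    ∃ (v : 𝒢.graph.Vertex) (b b' : 𝒢.graph.Branch) (hb : 𝒢.graph.abuts b = some v)
      (hb' : 𝒢.graph.abuts b' = some v) (ψ : 𝒢.Gv v →* D.levelGal) (x x' : 𝒢.Gv v),
      Function.Injective ψ ∧ (b' ≠ b ∨ x⁻¹ * x' ∉ 𝒢.branchSubgroup b v hb) ∧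
      ∀ g : c.G, (∀ i, (D.levelAct h𝒢 hconn i.1 (ρ g)).hom.vertexMap (w i) = w i ∧
        (D.levelAct h𝒢 hconn i.1 (ρ g)).hom.branchMap (β i) = β i ∧
        (D.levelAct h𝒢 hconn i.1 (ρ g)).hom.branchMap (β' i) = β' i) →
        D.toLevelGal h𝒢 hconn c ρ g ∈ ((𝒢.branchSubgroup b v hb).map (MulAut.conj x).toMonoidHom).map ψ ⊓
          ((𝒢.branchSubgroup b' v hb').map (MulAut.conj x').toMonoidHom).map ψ := by
  classical
  let I := {i : ℕ // j₀ ≤ i}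
  let i₀ : I := ⟨j₀, le_rfl⟩
  /- STEP 0: extend the system to all levels (below `j₀` by transport from `j₀`). -/
  let W : ∀ n, (D.S n).orbitGraph.Vertex := fun n =>
    if h : j₀ ≤ n then w ⟨n, h⟩ else (D.levelTrans (not_le.mp h).le).vertexMap (w i₀)
  let B : ∀ n, (D.S n).orbitGraph.Branch := fun n =>
    if h : j₀ ≤ n then β ⟨n, h⟩ else (D.levelTrans (not_le.mp h).le).branchMap (β i₀)
  let B' : ∀ n, (D.S n).orbitGraph.Branch := fun n =>
    if h : j₀ ≤ n then β' ⟨n, h⟩ else (D.levelTrans (not_le.mp h).le).branchMap (β' i₀)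
  have hW_of_le : ∀ n (h : j₀ ≤ n), W n = w ⟨n, h⟩ := fun n h => dif_pos h
  have hB_of_le : ∀ n (h : j₀ ≤ n), B n = β ⟨n, h⟩ := fun n h => dif_pos h
  have hB'_of_le : ∀ n (h : j₀ ≤ n), B' n = β' ⟨n, h⟩ := fun n h => dif_pos h
  have hW_of_lt : ∀ n (h : ¬ j₀ ≤ n), W n = (D.levelTrans (not_le.mp h).le).vertexMap (w i₀) :=
    fun n h => dif_neg h
  have hB_of_lt : ∀ n (h : ¬ j₀ ≤ n), B n = (D.levelTrans (not_le.mp h).le).branchMap (β i₀) :=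
    fun n h => dif_neg h
  have hB'_of_lt : ∀ n (h : ¬ j₀ ≤ n), B' n = (D.levelTrans (not_le.mp h).le).branchMap (β' i₀) :=
    fun n h => dif_neg h
  -- compatibility of the extended system
  have hWtrans : ∀ {n m : ℕ} (h : n ≤ m), (D.levelTrans h).vertexMap (W m) = W n := by
    intro n m h
    by_cases hm : j₀ ≤ m
    · by_cases hn : j₀ ≤ n
      · rw [hW_of_le m hm, hW_of_le n hn]; exact (hcompat (i := ⟨n, hn⟩) (i' := ⟨m, hm⟩) h).1
      · rw [hW_of_le m hm, hW_of_lt n hn, ← (hcompat (i := i₀) (i' := ⟨m, hm⟩) hm).1,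
          D.levelTrans_vertexMap_comp]
    · have hn : ¬ j₀ ≤ n := fun hn => hm (hn.trans h)
      rw [hW_of_lt m hm, hW_of_lt n hn, D.levelTrans_vertexMap_comp]
  have hBtrans : ∀ {n m : ℕ} (h : n ≤ m), (D.levelTrans h).branchMap (B m) = B n := by
    intro n m h
    by_cases hm : j₀ ≤ m
    · by_cases hn : j₀ ≤ n
      · rw [hB_of_le m hm, hB_of_le n hn]; exact (hcompat (i := ⟨n, hn⟩) (i' := ⟨m, hm⟩) h).2.1
      · rw [hB_of_le m hm, hB_of_lt n hn, ← (hcompat (i := i₀) (i' := ⟨m, hm⟩) hm).2.1,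
          D.levelTrans_branchMap_comp]
    · have hn : ¬ j₀ ≤ n := fun hn => hm (hn.trans h)
      rw [hB_of_lt m hm, hB_of_lt n hn, D.levelTrans_branchMap_comp]
  have hB'trans : ∀ {n m : ℕ} (h : n ≤ m), (D.levelTrans h).branchMap (B' m) = B' n := by
    intro n m h
    by_cases hm : j₀ ≤ m
    · by_cases hn : j₀ ≤ n
      · rw [hB'_of_le m hm, hB'_of_le n hn]; exact (hcompat (i := ⟨n, hn⟩) (i' := ⟨m, hm⟩) h).2.2
      · rw [hB'_of_le m hm, hB'_of_lt n hn, ← (hcompat (i := i₀) (i' := ⟨m, hm⟩) hm).2.2,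
          D.levelTrans_branchMap_comp]
    · have hn : ¬ j₀ ≤ n := fun hn => hm (hn.trans h)
      rw [hB'_of_lt m hm, hB'_of_lt n hn, D.levelTrans_branchMap_comp]
  -- the base vertex and branches
  let v : 𝒢.graph.Vertex := CovObj.OVertex.base _ (w i₀)
  let b : 𝒢.graph.Branch := (D.S j₀).orbitGraphProj.branchMap (β i₀)
  let b' : 𝒢.graph.Branch := (D.S j₀).orbitGraphProj.branchMap (β' i₀)
  have hb : 𝒢.graph.abuts b = some v := (D.S j₀).orbitGraphProj.abuts_branchMap (β i₀) (w i₀) (hpair i₀).2.1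
  have hb' : 𝒢.graph.abuts b' = some v := (D.S j₀).orbitGraphProj.abuts_branchMap (β' i₀) (w i₀) (hpair i₀).2.2
  have hWj : W j₀ = w i₀ := hW_of_le j₀ le_rfl
  have hBj : B j₀ = β i₀ := hB_of_le j₀ le_rfl
  have hB'j : B' j₀ = β' i₀ := hB'_of_le j₀ le_rfl
  have hWv : ∀ n, CovObj.OVertex.base _ (W n) = v := by
    intro n
    have h1 := D.base_levelTrans_vertexMap (Nat.zero_le n) (W n)
    have h2 := D.base_levelTrans_vertexMap (Nat.zero_le j₀) (W j₀)
    rw [hWtrans] at h1 h2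
    rw [hWj] at h2
    exact h1.symm.trans h2
  have hBb : ∀ n, (D.S n).orbitGraphProj.branchMap (B n) = b := by
    intro n
    have h1 := D.proj_branchMap_levelTrans (Nat.zero_le n) (B n)
    have h2 := D.proj_branchMap_levelTrans (Nat.zero_le j₀) (B j₀)
    rw [hBtrans] at h1 h2
    rw [hBj] at h2
    exact h1.symm.trans h2
  have hB'b : ∀ n, (D.S n).orbitGraphProj.branchMap (B' n) = b' := by
    intro n
    have h1 := D.proj_branchMap_levelTrans (Nat.zero_le n) (B' n)
    have h2 := D.proj_branchMap_levelTrans (Nat.zero_le j₀) (B' j₀)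
    rw [hB'trans] at h1 h2
    rw [hB'j] at h2
    exact h1.symm.trans h2
  have hBW : ∀ n, (D.S n).orbitGraph.abuts (B n) = some (W n) := by
    intro n
    by_cases hn : j₀ ≤ n
    · rw [hB_of_le n hn, hW_of_le n hn]; exact (hpair ⟨n, hn⟩).2.1
    · rw [hB_of_lt n hn, hW_of_lt n hn]
      exact (D.levelTrans (not_le.mp hn).le).abuts_branchMap (β i₀) (w i₀) (hpair i₀).2.1
  have hB'W : ∀ n, (D.S n).orbitGraph.abuts (B' n) = some (W n) := by
    intro n
    by_cases hn : j₀ ≤ n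
    · rw [hB'_of_le n hn, hW_of_le n hn]; exact (hpair ⟨n, hn⟩).2.2
    · rw [hB'_of_lt n hn, hW_of_lt n hn]
      exact (D.levelTrans (not_le.mp hn).le).abuts_branchMap (β' i₀) (w i₀) (hpair i₀).2.2
  -- one-step forms
  have hWstep : ∀ n, CovObj.OVertex.map (D.g n) (W (n + 1)) = W n := by
    intro n
    have := hWtrans (Nat.le_succ n)
    rw [D.levelTrans_le_succ] at this
    exact this
  have hBstep : ∀ n, (CovObj.orbitGraphMap (D.g n)).branchMap (B (n + 1)) = B n := by
    intro n
    have := hBtrans (Nat.le_succ n)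
    rw [D.levelTrans_le_succ] at this
    exact this
  have hB'step : ∀ n, (CovObj.orbitGraphMap (D.g n)).branchMap (B' (n + 1)) = B' n := by
    intro n
    have := hB'trans (Nat.le_succ n)
    rw [D.levelTrans_le_succ] at this
    exact this
  /- STEP 1: compatible base points `p n ∈ W n`. -/
  obtain ⟨p, hpW, hp⟩ := D.exists_ptSeq W hWv hWstep
  -- notation for the base-point embeddings and their kernels
  let φ : ∀ n, 𝒢.Gv v →* Aut (D.S n) := fun n => (D.S n).ptHom (hconn n) (D.htrans n) (p n)
  /- STEP 2: double-coset representatives of the branches, and their naturality (DN). -/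
  have hrep : ∀ n, ∃ y : 𝒢.Gv v, B n = (D.S n).brOf b hb (((φ n y).hom.fV v).hom.hom (p n)) := fun n =>
    (D.S n).exists_brOf_ptHom (hconn n) (D.htrans n) b hb (p n) (B n) (hBb n)
      ((hBW n).trans (congrArg some (hpW n).symm))
  have hrep' : ∀ n, ∃ y : 𝒢.Gv v, B' n = (D.S n).brOf b' hb' (((φ n y).hom.fV v).hom.hom (p n)) := fun n =>
    (D.S n).exists_brOf_ptHom (hconn n) (D.htrans n) b' hb' (p n) (B' n) (hB'b n)
      ((hB'W n).trans (congrArg some (hpW n).symm))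
  choose ys hys using hrep
  choose ys' hys' using hrep'
  have hDN : ∀ n, ys (n + 1) ∈ ((φ n).ker : Set (𝒢.Gv v)) * {ys n} * (𝒢.branchSubgroup b v hb : Set _) := by
    intro n
    refine D.mem_doubleCoset_of_branchMap_eq hconn p hp hb n (ys n) (ys (n + 1)) ?_
    rw [← hys (n + 1), ← hys n]
    exact hBstep n
  have hDN' : ∀ n, ys' (n + 1) ∈ ((φ n).ker : Set (𝒢.Gv v)) * {ys' n} * (𝒢.branchSubgroup b' v hb' : Set _) := by
    intro n
    refine D.mem_doubleCoset_of_branchMap_eq hconn p hp hb' n (ys' n) (ys' (n + 1)) ?_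
    rw [← hys' (n + 1), ← hys' n]
    exact hB'step n
  /- STEP 3: uniform representatives `y`, `y'` (compactness of `Π_v`). -/
  obtain ⟨y, hy⟩ := D.exists_uniform_rep hconn p hp hb ys hDN
  obtain ⟨y', hy'⟩ := D.exists_uniform_rep hconn p hp hb' ys' hDN'
  have hBy : ∀ n, B n = (D.S n).brOf b hb (((φ n y).hom.fV v).hom.hom (p n)) := fun n =>
    (hys n).trans ((D.S n).brOf_ptHom_eq_of_mem (hconn n) (D.htrans n) (p n) (hy n)).symm
  have hB'y : ∀ n, B' n = (D.S n).brOf b' hb' (((φ n y').hom.fV v).hom.hom (p n)) := fun n =>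
    (hys' n).trans ((D.S n).brOf_ptHom_eq_of_mem (hconn n) (D.htrans n) (p n) (hy' n)).symm
  /- STEP 4: the embedding `ψ = (ψ_{p n})_n : Π_v → ∏ Aut(S n)`, injective by (I0v). -/
  let ψ : 𝒢.Gv v →* D.levelGal := MonoidHom.pi φ
  have hψ : Function.Injective ψ := by
    refine (injective_iff_map_eq_one ψ).mpr fun h hh => hfaithV v h fun n x => ?_
    have h1 : φ n h = 1 := congrFun hh n
    rw [CovObj.ptHom_eq_one_iff] at h1
    obtain ⟨σ, hσ⟩ := (D.S n).exists_aut_fV_eq (hconn n) (D.htrans n) (p n) x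
    rw [← hσ, ← CovHom.fV_ρ, h1]
  refine ⟨v, b, b', hb, hb', ψ, y, y', hψ, ?_, fun g hg => ?_⟩
  · /- STEP 5: the two branch-cosets are distinct (else `β j₀ = β' j₀`). -/
    by_cases hbb : b' = b
    · right
      intro hyy
      apply (hpair i₀).1
      rw [← hBj, ← hB'j, hBy j₀, hB'y j₀]
      have hBB : ∀ (b₁ : 𝒢.graph.Branch) (h₁ : 𝒢.graph.abuts b₁ = some v), b₁ = b →
          ∀ z, (D.S j₀).brOf b₁ h₁ z = (D.S j₀).brOf b hb z := by
        rintro b₁ h₁ rfl z; rfl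
      rw [hBB b' hb' hbb, (D.S j₀).brOf_aut_eq_iff (hconn j₀) (D.htrans j₀) (p j₀)]
      exact ⟨y⁻¹ * y', hyy, by rw [map_mul, map_inv]⟩
    · left; exact hbb
  · /- STEP 6: an element fixing the system lies in both branch-conjugates. -/
    let q : ∀ n, Aut (D.S n) := fun n => D.toLevelGal h𝒢 hconn c ρ g n
    have hq_succ : ∀ n, q n = D.levelDesc hconn n (q (n + 1)) := fun n => D.toLevelGal_succ h𝒢 hconn c ρ g n
    -- `q n` fixes the extended system at every level
    have hfixB : ∀ n, (CovObj.orbitGraphMap (q n).hom).branchMap (B n) = B n := by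
      intro n
      change (D.levelAct h𝒢 hconn n (ρ g)).hom.branchMap (B n) = B n
      by_cases hn : j₀ ≤ n
      · rw [hB_of_le n hn]; exact (hg ⟨n, hn⟩).2.1
      · rw [hB_of_lt n hn, ← D.levelTrans_branchMap_act h𝒢 hconn c ρ g, (hg i₀).2.1]
    have hfixB' : ∀ n, (CovObj.orbitGraphMap (q n).hom).branchMap (B' n) = B' n := by
      intro n
      change (D.levelAct h𝒢 hconn n (ρ g)).hom.branchMap (B' n) = B' n
      by_cases hn : j₀ ≤ n
      · rw [hB'_of_le n hn]; exact (hg ⟨n, hn⟩).2.2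
      · rw [hB'_of_lt n hn, ← D.levelTrans_branchMap_act h𝒢 hconn c ρ g, (hg i₀).2.2]
    -- hence in the branch stabilisers `ψ_{p n}(y Π_b y⁻¹)`, `ψ_{p n}(y' Π_{b'} y'⁻¹)`
    have hmem : ∀ n, q n ∈ ((𝒢.branchSubgroup b v hb).map (MulAut.conj y).toMonoidHom).map (φ n) := by
      intro n
      have h1 := hfixB n
      rw [hBy n, (D.S n).stab_brOf_ptHom_iff (hconn n) (D.htrans n) (p n)] at h1
      exact h1
    have hmem' : ∀ n, q n ∈ ((𝒢.branchSubgroup b' v hb').map (MulAut.conj y').toMonoidHom).map (φ n) := by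
      intro n
      have h1 := hfixB' n
      rw [hB'y n, (D.S n).stab_brOf_ptHom_iff (hconn n) (D.htrans n) (p n)] at h1
      exact h1
    -- pass to the limit (compactness of `Π_e`, `Π_{e'}`)
    obtain ⟨e, he⟩ := D.exists_edge_lift hconn p hp hb y q hq_succ hmem
    obtain ⟨e', he'⟩ := D.exists_edge_lift hconn p hp hb' y' q hq_succ hmem'
    refine ⟨⟨y * 𝒢.brHom b v hb e * y⁻¹, ⟨𝒢.brHom b v hb e, ⟨e, rfl⟩, rfl⟩, funext fun n => he n⟩,
      ⟨y' * 𝒢.brHom b' v hb' e' * y'⁻¹, ⟨𝒢.brHom b' v hb' e', ⟨e', rfl⟩, rfl⟩, funext fun n => he' n⟩⟩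

/-- **(I4′)_cpt for the tower** — the v4 field `FiniteLevelDataCpt.stabBranchPairCpt'` (abc-iut-L3-t6's
`TemperedLevelDataCpt.lean`, cell ruling α12-1 on F-t6g3-1) in the binder shape of `finiteLevelDataOfTower`: for
every COMPACT `C ≤ c.G`, the elements of `C` fixing a compatible branch-pair system lie in two distinct
branch-conjugates after `toLevelGal`, which is injective ON `C`. Inputs: the core, (I0c) injectivity of
`toLevelGal` on compact subgroups (abc-iut-L3-t6's `injOn_of_isCompact_of_ker_le`: the deck kernel meets compact
subgroups trivially — any tower) and (I0v). [cite: MochizukiSemiAnbd2006, Thm 3.7(iii) p.41] -/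
theorem stabBranchPairCpt'_ofTower (c : TemperedPiChart 𝒢) (ρ : c.G →* D.temperedPi h𝒢)
    (hfaithC : ∀ C : Subgroup c.G, IsCompact (C : Set c.G) → Set.InjOn (D.toLevelGal h𝒢 hconn c ρ) C)
    (hfaithV : ∀ (v : 𝒢.graph.Vertex) (h : 𝒢.Gv v),
      (∀ (n : ℕ) (x : ((D.S n).SV v).obj.V), ((D.S n).SV v).obj.ρ h x = x) → h = 1)
    (C : Subgroup c.G) (hC : IsCompact (C : Set c.G))
    (j₀ : ℕ) (w : ∀ i : {i : ℕ // j₀ ≤ i}, (D.S i.1).orbitGraph.Vertex)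
    (β β' : ∀ i : {i : ℕ // j₀ ≤ i}, (D.S i.1).orbitGraph.Branch)
    (hpair : ∀ i, β i ≠ β' i ∧ (D.S i.1).orbitGraph.abuts (β i) = some (w i) ∧
      (D.S i.1).orbitGraph.abuts (β' i) = some (w i))
    (hcompat : ∀ ⦃i i' : {i : ℕ // j₀ ≤ i}⦄ (h : i.1 ≤ i'.1), (D.levelTrans h).vertexMap (w i') = w i ∧
      (D.levelTrans h).branchMap (β i') = β i ∧ (D.levelTrans h).branchMap (β' i') = β' i) :
    ∃ (Q : Type u) (_ : Group Q) (ιQ : c.G →* Q) (v : 𝒢.graph.Vertex) (b b' : 𝒢.graph.Branch)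
      (hb : 𝒢.graph.abuts b = some v) (hb' : 𝒢.graph.abuts b' = some v) (ψ : 𝒢.Gv v →* Q) (x x' : 𝒢.Gv v),
      Set.InjOn ιQ C ∧ Function.Injective ψ ∧ (b' ≠ b ∨ x⁻¹ * x' ∉ 𝒢.branchSubgroup b v hb) ∧
      ∀ g ∈ C, (∀ i, (D.levelAct h𝒢 hconn i.1 (ρ g)).hom.vertexMap (w i) = w i ∧
        (D.levelAct h𝒢 hconn i.1 (ρ g)).hom.branchMap (β i) = β i ∧
        (D.levelAct h𝒢 hconn i.1 (ρ g)).hom.branchMap (β' i) = β' i) →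
        ιQ g ∈ ((𝒢.branchSubgroup b v hb).map (MulAut.conj x).toMonoidHom).map ψ ⊓
          ((𝒢.branchSubgroup b' v hb').map (MulAut.conj x').toMonoidHom).map ψ := by
  obtain ⟨v, b, b', hb, hb', ψ, x, x', hψ, hne, hmem⟩ :=
    D.toLevelGal_mem_of_fixes_branchPairSystem h𝒢 hconn c ρ hfaithV j₀ w β β' hpair hcompat
  exact ⟨D.levelGal, inferInstance, D.toLevelGal h𝒢 hconn c ρ, v, b, b', hb, hb', ψ, x, x', hfaithC C hC, hψ, hne,
    fun g _ hg => hmem g hg⟩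

/-- **(I0c) for `toLevelGal`**: for `ρ` continuous and injective, `toLevelGal` is injective on every compact
subgroup of `c.G` (abc-iut-L3-t6's `injOn_pi_descendBaseAut_proj_of_isCompact`: the deck kernel meets compact
subgroups of `π₁^temp` trivially — any tower, no cofinality). [cite: MochizukiSemiAnbd2006, Thm 3.7(iii) p.41] -/
theorem injOn_toLevelGal_of_isCompact (c : TemperedPiChart 𝒢) (ρ : c.G →* D.temperedPi h𝒢)
    (hρc : Continuous ρ) (hρi : Function.Injective ρ) (C : Subgroup c.G) (hC : IsCompact (C : Set c.G)) :
    Set.InjOn (D.toLevelGal h𝒢 hconn c ρ) C := by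
  intro g hg g' hg' heq
  apply hρi
  have hC' : IsCompact ((C.map ρ : Subgroup (D.temperedPi h𝒢)) : Set (D.temperedPi h𝒢)) := by
    rw [Subgroup.coe_map]; exact hC.image hρc
  exact D.injOn_pi_descendBaseAut_proj_of_isCompact h𝒢 hconn (C.map ρ) hC' ⟨g, hg, rfl⟩ ⟨g', hg', rfl⟩
    (funext fun n => congrFun heq n)

/-- **(I4′)_cpt for the tower, with (I0c) discharged**: for `ρ : c.G → π₁^temp` continuous and injective (e.g.
the identity of the tower chart) the v4 field `FiniteLevelDataCpt.stabBranchPairCpt'` holds for the tower modulo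
only the faithfulness (I0v) of the vertex groups on the tower's vertex fibres (abc-iut-L3-t6's
`TemperedPiFibreFaithful.lean` for the tower of Prop. 3.6). [cite: MochizukiSemiAnbd2006, Thm 3.7(iii) p.41] -/
theorem stabBranchPairCpt'_ofTower' (c : TemperedPiChart 𝒢) (ρ : c.G →* D.temperedPi h𝒢)
    (hρc : Continuous ρ) (hρi : Function.Injective ρ)
    (hfaithV : ∀ (v : 𝒢.graph.Vertex) (h : 𝒢.Gv v),
      (∀ (n : ℕ) (x : ((D.S n).SV v).obj.V), ((D.S n).SV v).obj.ρ h x = x) → h = 1)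
    (C : Subgroup c.G) (hC : IsCompact (C : Set c.G))
    (j₀ : ℕ) (w : ∀ i : {i : ℕ // j₀ ≤ i}, (D.S i.1).orbitGraph.Vertex)
    (β β' : ∀ i : {i : ℕ // j₀ ≤ i}, (D.S i.1).orbitGraph.Branch)
    (hpair : ∀ i, β i ≠ β' i ∧ (D.S i.1).orbitGraph.abuts (β i) = some (w i) ∧
      (D.S i.1).orbitGraph.abuts (β' i) = some (w i))
    (hcompat : ∀ ⦃i i' : {i : ℕ // j₀ ≤ i}⦄ (h : i.1 ≤ i'.1), (D.levelTrans h).vertexMap (w i') = w i ∧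
      (D.levelTrans h).branchMap (β i') = β i ∧ (D.levelTrans h).branchMap (β' i') = β' i) :
    ∃ (Q : Type u) (_ : Group Q) (ιQ : c.G →* Q) (v : 𝒢.graph.Vertex) (b b' : 𝒢.graph.Branch)
      (hb : 𝒢.graph.abuts b = some v) (hb' : 𝒢.graph.abuts b' = some v) (ψ : 𝒢.Gv v →* Q) (x x' : 𝒢.Gv v),
      Set.InjOn ιQ C ∧ Function.Injective ψ ∧ (b' ≠ b ∨ x⁻¹ * x' ∉ 𝒢.branchSubgroup b v hb) ∧
      ∀ g ∈ C, (∀ i, (D.levelAct h𝒢 hconn i.1 (ρ g)).hom.vertexMap (w i) = w i ∧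
        (D.levelAct h𝒢 hconn i.1 (ρ g)).hom.branchMap (β i) = β i ∧
        (D.levelAct h𝒢 hconn i.1 (ρ g)).hom.branchMap (β' i) = β' i) →
        ιQ g ∈ ((𝒢.branchSubgroup b v hb).map (MulAut.conj x).toMonoidHom).map ψ ⊓
          ((𝒢.branchSubgroup b' v hb').map (MulAut.conj x').toMonoidHom).map ψ :=
  D.stabBranchPairCpt'_ofTower h𝒢 hconn c ρ (D.injOn_toLevelGal_of_isCompact h𝒢 hconn c ρ hρc hρi) hfaithV C hC
    j₀ w β β' hpair hcompat

end GaloisLevelData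

end ProfiniteSemiGraph

end Literature.AnabelianGeometry.SemiGraphs
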